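import Summits.QuantumFields.YangMills.Theorems.HyperbolicRegulatorCurvatureUniformityRStubChartInterior

/-!
# Route `HyperbolicRegulator`, crux `CurvatureUniformityR` (stmt-QuantumFields-18154), line `single-chart-markov`:
# helpers for the stub `stub_sumMatch` (I) — link values, trace invariances, the normal form of a square boundary word

Helper file (lead `prover-line-stmt-QuantumFields-18154-0`) for the registered stub
`stub_sumMatch : ChartInteriorStructure → PlaquetteSumMatch` of the skeleton `Cruxes/CurvatureUniformityR/Lines/Sketch.lean`.
Elementary facts, nothing asserted about the route:

* `linkVal_not` / `linkVal_piecewise_of_forall_notMem` — flipping the orientation flag inverts the link value; resampling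
  links off `e` does not change the value at `e`;
* `retr_comm` / `retr_inv` — `Re tr r.ρ (g h) = Re tr r.ρ (h g)` and `Re tr r.ρ g⁻¹ = Re tr r.ρ g` (unitarity of `r.ρ`);
* `square_word_normal_form` — a closed boundary word of length four (consecutive flagged edges) whose edge ids are
  pairwise distinct and are the ids of a reference 4-cycle with pairwise distinct corners IS that cycle read from some
  corner in one of the two directions; `retr_word_eq` — hence its holonomy has the same `Re tr ρ`;
-/

set_option autoImplicit false

namespace Summit.QuantumFields.YangMills.Cruxes.CurvatureUniformityR.SingleChartMarkov

open Finset Summit.QuantumFields.YangMills.Theorems.HyperbolicToTorus.Negative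
open Literature.MathematicalPhysics.QuantumFieldTheory (LatticeRep)

namespace StubSumMatch

open StubChartInterior

/-! ### Link values -/

section LinkVal

variable {G : Type} [Group G] {V E : Finset ℕ}

/-- Flipping the orientation flag inverts the link value. -/
theorem linkVal_not (U : ↥(PE V E) → G) (e : (ℕ × ℕ) ⊕ (ℕ × ℕ)) (b : Bool) :
    linkVal U (e, !b) = (linkVal U (e, b))⁻¹ := by
  unfold linkVal
  dsimp only
  split_ifs with h <;> cases b <;> simp_all

/-- The reversed link value is the inverse of the forward one. -/
theorem linkVal_false (U : ↥(PE V E) → G) (e : (ℕ × ℕ) ⊕ (ℕ × ℕ)) :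
    linkVal U (e, false) = (linkVal U (e, true))⁻¹ :=
  linkVal_not U e true

/-- Resampling the links of a set avoiding `e.1` does not change the link value at `e`. -/
theorem linkVal_piecewise_of_forall_notMem (s : Finset ↥(PE V E)) [DecidablePred (· ∈ s)]
    (W U : ↥(PE V E) → G) (e : ((ℕ × ℕ) ⊕ (ℕ × ℕ)) × Bool)
    (h : ∀ he : e.1 ∈ PE V E, (⟨e.1, he⟩ : ↥(PE V E)) ∉ s) :
    linkVal (s.piecewise W U) e = linkVal U e := by
  unfold linkVal
  split_ifs with he hb
  · rw [Finset.piecewise_eq_of_notMem _ _ _ (h he)]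
  · rw [Finset.piecewise_eq_of_notMem _ _ _ (h he)]
  · rfl

end LinkVal

/-! ### Trace invariances -/

section Retr

variable {G : Type} [Group G] [TopologicalSpace G] (r : LatticeRep G)

/-- Cyclicity: `Re tr ρ(g h) = Re tr ρ(h g)`. -/
theorem retr_comm (g h : G) : (r.ρ (g * h)).trace.re = (r.ρ (h * g)).trace.re := by
  rw [map_mul, map_mul, Matrix.trace_mul_comm]

/-- Unitarity: `Re tr ρ(g⁻¹) = Re tr ρ(g)` (`ρ(g⁻¹) = ρ(g)ᴴ`). -/
theorem retr_inv (g : G) : (r.ρ g⁻¹).trace.re = (r.ρ g).trace.re := by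
  have h1 : r.ρ g⁻¹ * r.ρ g = 1 := by rw [← map_mul, inv_mul_cancel, map_one]
  have h2 : r.ρ g⁻¹ = star (r.ρ g) :=
    calc r.ρ g⁻¹ = r.ρ g⁻¹ * (r.ρ g * star (r.ρ g)) := by
          rw [Unitary.mul_star_self_of_mem (r.mem_unitary g), mul_one]
      _ = star (r.ρ g) := by rw [← mul_assoc, h1, one_mul]
  rw [h2, Matrix.star_eq_conjTranspose, Matrix.trace_conjTranspose, Complex.star_def, Complex.conj_re]

/-- Rotation by one of a four-letter word. -/
theorem retr_rot (a b c d : G) :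
    (r.ρ (a * b * c * d)).trace.re = (r.ρ (b * c * d * a)).trace.re := by
  have h := retr_comm r a (b * c * d)
  simpa only [mul_assoc] using h

/-- Reversal of a four-letter word. -/
theorem retr_rev (a b c d : G) :
    (r.ρ (a⁻¹ * b⁻¹ * c⁻¹ * d⁻¹)).trace.re = (r.ρ (d * c * b * a)).trace.re := by
  rw [← retr_inv r (d * c * b * a)]
  simp only [mul_inv_rev, mul_assoc]

end Retr

/-! ### The normal form of a square boundary word -/

section Word

variable {σ τ : ℕ → ℕ}

/-- The start of the reversed flagged edge `(e.1, !e.2)` is the end of `e` (start `st (e, b) = if b then σ e else τ e`,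
end `en (e, b) = if b then τ e else σ e`, as in the route's vocabulary). -/
theorem st_rev (σ τ : ℕ → ℕ) (e : ℕ × Bool) :
    (if (e.1, !e.2).2 then σ (e.1, !e.2).1 else τ (e.1, !e.2).1) = (if e.2 then τ e.1 else σ e.1) := by
  obtain ⟨e, b⟩ := e
  cases b <;> rfl

/-- The end of the reversed flagged edge is the start of the edge. -/
theorem en_rev (σ τ : ℕ → ℕ) (e : ℕ × Bool) :
    (if (e.1, !e.2).2 then τ (e.1, !e.2).1 else σ (e.1, !e.2).1) = (if e.2 then σ e.1 else τ e.1) := by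
  obtain ⟨e, b⟩ := e
  cases b <;> rfl

/-- Two flagged edges with the same id are equal or reverse to each other. -/
theorem eq_or_eq_rev_of_fst_eq {e e' : ℕ × Bool} (h : e'.1 = e.1) : e' = e ∨ e' = (e.1, !e.2) := by
  obtain ⟨e, b⟩ := e
  obtain ⟨e', b'⟩ := e'
  simp only at h
  subst h
  cases b <;> cases b' <;> simp

/-- **Square word normal form.** `c` is a reference closed 4-cycle of flagged edges (`st (c i) = v i`,
`en (c i) = v (i + 1)`) with pairwise distinct corners `v`; `w` is a closed consecutive word (`en (w i) = st (w (i + 1))`)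
whose ids are pairwise distinct and among the ids of `c`. Then `w` is `c` read from some corner, forwards or backwards
(reversed edges `(e.1, !e.2)`). -/
theorem square_word_normal_form {c w : Fin 4 → ℕ × Bool} {v : Fin 4 → ℕ} (hv : Function.Injective v)
    (hcs : ∀ i, (if (c i).2 then σ (c i).1 else τ (c i).1) = v i)
    (hce : ∀ i, (if (c i).2 then τ (c i).1 else σ (c i).1) = v (i + 1))
    (hw : ∀ i, (if (w i).2 then τ (w i).1 else σ (w i).1) = (if (w (i + 1)).2 then σ (w (i + 1)).1 else τ (w (i + 1)).1))
    (hwi : Function.Injective (Prod.fst ∘ w)) (hids : ∀ i, ∃ m, (w i).1 = (c m).1) :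
    ∃ s : Fin 4, (∀ i, w i = c (s + i)) ∨ (∀ i, w i = ((c (s - i)).1, !(c (s - i)).2)) := by
  -- reversed reference edges
  have hrs : ∀ m, (if ((c m).1, !(c m).2).2 then σ ((c m).1, !(c m).2).1 else τ ((c m).1, !(c m).2).1) = v (m + 1) :=
    fun m => by rw [← hce m]; exact st_rev σ τ (c m)
  have hre : ∀ m, (if ((c m).1, !(c m).2).2 then τ ((c m).1, !(c m).2).1 else σ ((c m).1, !(c m).2).1) = v m :=
    fun m => by rw [← hcs m]; exact en_rev σ τ (c m)
  -- one forward step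
  have fwd : ∀ i m, w i = c m → w (i + 1) = c (m + 1) := by
    intro i m h
    obtain ⟨m', hm'⟩ := hids (i + 1)
    have hst : (if (w (i + 1)).2 then σ (w (i + 1)).1 else τ (w (i + 1)).1) = v (m + 1) := by rw [← hw i, h, hce]
    rcases eq_or_eq_rev_of_fst_eq hm' with h' | h'
    · rw [h', hcs] at hst
      rw [h', hv hst]
    · rw [h', hrs] at hst
      have hmm : m' = m := by simpa using hv hst
      have : (Prod.fst ∘ w) (i + 1) = (Prod.fst ∘ w) i := by
        simp only [Function.comp_apply, hm', hmm, h]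
      exact absurd (hwi this) (by simp)
  -- one backward step
  have bwd : ∀ i m, w i = ((c m).1, !(c m).2) → w (i + 1) = ((c (m - 1)).1, !(c (m - 1)).2) := by
    intro i m h
    obtain ⟨m', hm'⟩ := hids (i + 1)
    have hst : (if (w (i + 1)).2 then σ (w (i + 1)).1 else τ (w (i + 1)).1) = v m := by rw [← hw i, h, hre]
    rcases eq_or_eq_rev_of_fst_eq hm' with h' | h'
    · rw [h', hcs] at hst
      have hmm : m' = m := hv hst
      have : (Prod.fst ∘ w) (i + 1) = (Prod.fst ∘ w) i := by
        simp only [Function.comp_apply, hm', hmm, h]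
      exact absurd (hwi this) (by simp)
    · rw [h', hrs] at hst
      have hmm : m' = m - 1 := by
        have := hv hst
        rw [← this]; simp
      rw [h', hmm]
  obtain ⟨m, hm⟩ := hids 0
  rcases eq_or_eq_rev_of_fst_eq hm with h0 | h0
  · have h1 := fwd 0 m h0
    have h2 := fwd _ _ h1
    have h3 := fwd _ _ h2
    refine ⟨m, Or.inl fun i => ?_⟩
    fin_cases i
    · simpa using h0
    · simpa using h1
    · simpa [add_assoc, show (1 : Fin 4) + 1 = 2 from rfl] using h2
    · simpa [add_assoc, show (1 : Fin 4) + (1 + 1) = 3 from rfl] using h3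
  · have h1 := bwd 0 m h0
    have h2 := bwd _ _ h1
    have h3 := bwd _ _ h2
    refine ⟨m, Or.inr fun i => ?_⟩
    fin_cases i
    · simpa using h0
    · simpa using h1
    · simpa [sub_sub, show (1 : Fin 4) + 1 = 2 from rfl] using h2
    · simpa [sub_sub, show (1 : Fin 4) + (1 + 1) = 3 from rfl] using h3

/-- **Equal weights from the normal form.** For a flag-respecting reading `φ` of flagged edges
(`φ (e.1, !e.2) = (φ e)⁻¹`), a word in normal form relative to `c` has the same `Re tr ρ` of its holonomy as `c`
(trace cyclicity and inversion invariance). -/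
theorem retr_word_eq {G : Type} [Group G] [TopologicalSpace G] (r : LatticeRep G) (φ : ℕ × Bool → G)
    (hφ : ∀ e : ℕ × Bool, φ (e.1, !e.2) = (φ e)⁻¹) {c w : Fin 4 → ℕ × Bool}
    (h : ∃ s : Fin 4, (∀ i, w i = c (s + i)) ∨ (∀ i, w i = ((c (s - i)).1, !(c (s - i)).2))) :
    (r.ρ (φ (w 0) * φ (w 1) * φ (w 2) * φ (w 3))).trace.re =
      (r.ρ (φ (c 0) * φ (c 1) * φ (c 2) * φ (c 3))).trace.re := by
  obtain ⟨s, h | h⟩ := h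
  · simp only [h]
    fin_cases s
    · simp
    · simp only [Fin.mk_one, Fin.isValue, add_zero, Fin.reduceAdd]
      rw [← retr_rot]
    · simp only [Fin.reduceFinMk, Fin.isValue, add_zero, Fin.reduceAdd]
      rw [retr_rot, retr_rot]
    · simp only [Fin.reduceFinMk, Fin.isValue, add_zero, Fin.reduceAdd]
      rw [retr_rot]
  · simp only [h, hφ]
    fin_cases s
    · simp only [Fin.zero_eta, Fin.isValue, sub_zero, Fin.reduceSub]
      rw [retr_rev, ← retr_rot]
    · simp only [Fin.mk_one, Fin.isValue, sub_zero, sub_self, Fin.reduceSub]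
      rw [retr_rev, retr_rot, retr_rot]
    · simp only [Fin.reduceFinMk, Fin.isValue, sub_zero, Fin.reduceSub, sub_self]
      rw [retr_rev, retr_rot]
    · simp only [Fin.reduceFinMk, Fin.isValue, sub_zero, Fin.reduceSub, sub_self]
      rw [retr_rev]

end Word

end StubSumMatch

end Summit.QuantumFields.YangMills.Cruxes.CurvatureUniformityR.SingleChartMarkov
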